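import Mathlib
import Summits.NavierStokesRegularity.NavierStokesRegularity.Theorems.TaoLadderRungTwoFlatBehindHopEnergy
import HarnessLib

/-!
# The ENVELOPE obligation, behind part: shells `k ≤ −K` from the in-hop behind BLOCK ENERGIES (helper for the K_A♭ parent item
  stmt-NavierStokesRegularity-22987 `FlatGapCertificatesV2`, route TaoLadderRungTwoFlat; cell harvest/h2-tao-ladder, p1 g24; LADDER §50.8–50.9, §54)

`HopTube.TubeStepEnvelopeWith … env₀ … n` asks `F i k s ≤ env₀ k` along the hop; for zero-slack exact premise flows `F ≤ ½S²`
(`HopTube.energy_le_half_sq_of_premiseFlow`, …EnvelopeAhead). Behind the window (`k ≤ −K`) the in-hop a-priori loop of record delivers the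
geometrically weighted BLOCK ENERGIES `coMovingEnergyOn [1−K−L, −K] θ′ (−K + σt) S t ≤ V₀ + Ē_top·t` for every depth `L`
(`R54.behind_blockEnergy_le_of_apriori`); one term of the block gives the per-shell amplitude, growing like `e^{θ′|k|/2}` into the wake —
exactly the growth of the envelope's behind branch `Eb·(1+ε₀)^{2θ_b|k|}` when `θ′ ≤ 2θ_b·log(1+ε₀)` (`tubeEnv`, LADDER §50.9).

* `sq_le_of_blockEnergies` — `S i k t² ≤ 2·e^{θ′(−K + σt − k)}·V` for `k ≤ −K` from the block energies `≤ V` at all depths;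
* `envelopeBehind_of_blockEnergies` — with `F ≤ ½S²`, `σt ≤ 1` and the row `e^{θ′(1 − K − k)}·V ≤ env₀ k`: `F i k t ≤ env₀ k` for `k ≤ −K`.

HONEST FRAMING: bookkeeping over MODEL-lattice certificate flows (graded mirror table on `S♭`); the block-energy level `V` and the envelope
rows are HYPOTHESES (in-hop outputs of the behind a-priori loop / scalar schedule); nothing certified; no item closed; nothing about the
Navier–Stokes equations.
-/

noncomputable section

-- the sub-problem namespace repeats the summit name by design (D-0017)
set_option linter.dupNamespace false

namespace Summit.NavierStokesRegularity.NavierStokesRegularity.Theorems.HopTube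

open Set Finset Literature.Analysis.FluidPDE Literature.Analysis.FluidPDE.TaoCascade MirrorPulse

/-- **One shell out of the block energies.** If every behind block `[1−K−L, −K]` has weighted energy `≤ V` at time `t` (weight
`e^{θ′(k − n_e)}`, `n_e = −K + σt`), then for every `k ≤ −K`: `S i k t² ≤ 2·e^{θ′(n_e − k)}·V`.
[cite: Tao2016AveragedNS, §4 (4.3) (weighted energies, statement shape); cell LADDER §54 (R54-1 block energies), §50.9 (envelope behind branch)] -/
theorem sq_le_of_blockEnergies {K : ℕ} {θ' σ V t : ℝ} {S : Fin 2 → ℤ → ℝ → ℝ}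
    (hblock : ∀ L : ℕ, coMovingEnergyOn (Finset.Icc (1 - (K : ℤ) - L) (-(K : ℤ))) θ' (-(K : ℝ) + σ * t) S t ≤ V)
    (i : Fin 2) {k : ℤ} (hk : k ≤ -(K : ℤ)) :
    S i k t ^ 2 ≤ 2 * (Real.exp (θ' * ((-(K : ℝ) + σ * t) - (k : ℝ))) * V) := by
  set L : ℕ := (1 - (K : ℤ) - k).toNat with hL
  have hLk : ((L : ℕ) : ℤ) = 1 - (K : ℤ) - k := by rw [hL]; exact Int.toNat_of_nonneg (by omega)
  have hmem : k ∈ Finset.Icc (1 - (K : ℤ) - L) (-(K : ℤ)) := by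
    rw [Finset.mem_Icc]; constructor <;> omega
  have h1 := sq_le_exp_mul_coMovingEnergyOn (Finset.Icc (1 - (K : ℤ) - L) (-(K : ℤ))) θ' (-(K : ℝ) + σ * t) S t hmem i
  have h2 : Real.exp (θ' * ((-(K : ℝ) + σ * t) - (k : ℝ)))
      * coMovingEnergyOn (Finset.Icc (1 - (K : ℤ) - L) (-(K : ℤ))) θ' (-(K : ℝ) + σ * t) S t
        ≤ Real.exp (θ' * ((-(K : ℝ) + σ * t) - (k : ℝ))) * V :=
    mul_le_mul_of_nonneg_left (hblock L) (Real.exp_pos _).le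
  linarith

/-- **BEHIND PART OF THE ENVELOPE from the block energies**: with `F ≤ ½S²` (zero-slack exact flow), block energies `≤ V` at all
depths at time `t`, `σt ≤ 1`, `0 ≤ θ′`, `0 ≤ V`, and the scalar row `e^{θ′(1 − K − k)}·V ≤ env₀ k` for `k ≤ −K`: `F i k t ≤ env₀ k` for every
`k ≤ −K`. [cite: Tao2016AveragedNS, §6.2 Prop. 6.3 (ix), §4 (4.3); cell LADDER §50.9 (`tubeEnv` behind branch `Eb(1+ε₀)^{2θ_b|k|}`), §54] -/
theorem envelopeBehind_of_blockEnergies {K : ℕ} {θ' σ V t : ℝ} {S F : Fin 2 → ℤ → ℝ → ℝ} {env₀ : ℤ → ℝ}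
    (hθ : 0 ≤ θ') (hV : 0 ≤ V) (hσt : σ * t ≤ 1)
    (hF : ∀ (i : Fin 2) (k : ℤ), F i k t ≤ (1 / 2) * S i k t ^ 2)
    (hblock : ∀ L : ℕ, coMovingEnergyOn (Finset.Icc (1 - (K : ℤ) - L) (-(K : ℤ))) θ' (-(K : ℝ) + σ * t) S t ≤ V)
    (henv : ∀ k : ℤ, k ≤ -(K : ℤ) → Real.exp (θ' * ((1 : ℝ) - K - k)) * V ≤ env₀ k) :
    ∀ (i : Fin 2) (k : ℤ), k ≤ -(K : ℤ) → F i k t ≤ env₀ k := by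
  intro i k hk
  have hsq := sq_le_of_blockEnergies hblock i hk
  have hw : Real.exp (θ' * ((-(K : ℝ) + σ * t) - (k : ℝ))) ≤ Real.exp (θ' * ((1 : ℝ) - K - k)) := by
    rw [Real.exp_le_exp]
    exact mul_le_mul_of_nonneg_left (by linarith) hθ
  have hwV := mul_le_mul_of_nonneg_right hw hV
  calc F i k t ≤ (1 / 2) * S i k t ^ 2 := hF i k
    _ ≤ Real.exp (θ' * ((-(K : ℝ) + σ * t) - (k : ℝ))) * V := by linarith
    _ ≤ Real.exp (θ' * ((1 : ℝ) - K - k)) * V := hwV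
    _ ≤ env₀ k := henv k hk

end Summit.NavierStokesRegularity.NavierStokesRegularity.Theorems.HopTube

end
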